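import Summits.ResolutionOfSingularities.ResolutionOfSingularities.Theorems.DeltaCutStellarLatJ

/-!
# StellarCut J21b — «LatJet»: TRANSPORT OF THE LATENT-JET DATUM through a latent hop (lens-6, g36 door 2)

The latent hop blows up the codimension-two face `V(H) ∩ V(K)` of a member `K` with positive latent label (L20).  At a point `x'` of
the strict transform `V(H')` over `y`, L20b's bookkeeping gives the new Artin–Schreier presentation with
`h' = h₀·v₁`, `π^*m_b = m_b'·v₂`, `π^*m_μ = ε·m_μ'·v₃`, `c' = π^*c·v₃`, `v' = π^*v·v₂·v₃^{p−1}` — hence the NEW twisted terminal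
monomial is `v'·c'·m_b' = π^*(v·c·m_b)·v₃ᵖ`.  The derivation extends through the round (T19a-ii `exists_isDeriv_transform`, BY NAME),
stays logarithmic along the new frame (T19c's transport, re-instantiated for the face `{H, K}`), and — the point of the class —
the eigen relation is transported EXACTLY: `δ'(v₃ᵖ) = p·v₃^{p−1}·δ'v₃ = 0` because `p = 0` in the stalks, so
`δ'(v'c'm_b') = v₃ᵖ·π^*(δ(v c m_b)) = π^*λ·(v'c'm_b')` with the unit eigenvalue `λ' = π^*λ`.

* `ncHypShapeLatJ.latJAt_transform` — ★ the datum after the hop (presentation: L20b's computation; derivation: new).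
* `ncHypShapeLatJ.transform_of_support_subset` — the shape after the hop, given the guard `supp M' ⊆ V(H')` (J21c supplies it).

0 sorry; axioms standard. [new] [cite: Kollar2007, (3.111) Step 3] [cite: CossartPiltant2008, Prop. 4.2] [cite: StacksProject, Tag 0804]
[cite: Cutkosky2011, §8]
-/
noncomputable section

open CategoryTheory CategoryTheory.Limits AlgebraicGeometry TopologicalSpace IsLocalRing
open Literature.AlgebraicGeometry.Resolution

namespace Summit.ResolutionOfSingularities.ResolutionOfSingularities.Theorems.DeltaCutClasses

open Summit.ResolutionOfSingularities.ResolutionOfSingularities.Theorems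
open WeakOrderReduction ForcedTowerClasses

section Round

variable {X X' : Scheme.{0}} [IsLocallyNoetherian X] {π : X' ⟶ X} {H K : X.IdealSheafData}
  {E L : List (X.IdealSheafData × ℕ)} {p : ℕ} {M : MarkedIdeal X}

/-- ★ **THE LATENT-JET DATUM SURVIVES THE LATENT HOP**: after blowing up the face `{H, K}` (`expOf L K ≥ 1`) of a
`ncHypShapeLatJ`-datum, at every `x' ∈ V(H')` there is a latent-jet datum for the transformed ideal with terminal labels at marking
`0` and latent labels at marking `1`: the Artin–Schreier presentation is L20b's, the derivation is the chart extension `δ'`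
(logarithmic along the new frame), the eigenvalue is `π^*λ` — exact because `δ'(v₃ᵖ) = 0`. [new] [cite: Kollar2007, (3.111) Step 3]
[cite: StacksProject, Tag 0804] -/
theorem ncHypShapeLatJ.latJAt_transform (hEs : HasSNC (H :: boundaryOf E)) (hK : K ∈ boundaryOf E) (hHK : H ≠ K)
    (hπ : IsBlowup π ((pairFace H K).sup id)) (hLK : 1 ≤ expOf L K) (hP : ncHypShapeLatJ p X E L H M) {x' : X'}
    (hx' : x' ∈ (strictTransformIdeal π ((pairFace H K).sup id) H).support) :
    LatJAt p (transformExp E π (pairFace H K) 0) (transformExp L π (pairFace H K) 1)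
      (strictTransformIdeal π ((pairFace H K).sup id) H) (M.transform π ((pairFace H K).sup id)).ideal x' := by
  classical
  haveI : IsProper π := hπ.isProper
  haveI : IsLocallyNoetherian X' := LocallyOfFiniteType.isLocallyNoetherian π
  set T := pairFace H K with hTdef
  have hT : ∀ K' ∈ T, K' ∈ H :: boundaryOf E := pair_subset_frame hK
  have hEsL : HasSNC (H :: boundaryOf L) := hP.hasSNC_L hEs
  have hTL : ∀ K' ∈ T, K' ∈ H :: boundaryOf L := by rw [hP.boundaryOf_eq]; exact hT
  have hEs' : HasSNC (strictTransformIdeal π (T.sup id) H :: boundaryOf (transformExp E π T 0)) :=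
    hasSNC_ncShape_transform hEs hT hπ 0
  have hEsL' : HasSNC (strictTransformIdeal π (T.sup id) H :: boundaryOf (transformExp L π T 1)) :=
    hasSNC_ncShape_transform hEsL hTL hπ 1
  haveI : IsRegularLocalRing (X'.presheaf.stalk x') := (hEs' x').1
  haveI : IsDomain (X'.presheaf.stalk x') := isDomain_of_isRegularLocalRing _
  have hy : π x' ∈ H.support := mem_support_of_mem_support_strictTransformIdeal hx'
  obtain ⟨h, mb, mμ, c, v, δ, lam, hc, hv, hHx, hbx, hμx, hIx, hδ, hlog, hlam, heig⟩ := hP.latJAt hy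
  obtain ⟨h₀, -, hH₀⟩ := exists_ne_zero_stalkIdeal_eq_span hEs' List.mem_cons_self x'
  obtain ⟨ε, hε0, hε⟩ := exists_ne_zero_stalkIdeal_eq_span hEs' (comap_mem_frame_transform 0) x'
  obtain ⟨mb', hmb'⟩ := exists_stalkIdeal_monomialIdeal_eq_span (hasSNC_boundaryOf_of_cons hEs') x'
  obtain ⟨mμ', hmμ'⟩ := exists_stalkIdeal_monomialIdeal_eq_span (hasSNC_boundaryOf_of_cons hEsL') x'
  set φ := (π.stalkMap x').hom with hφ
  -- (a) `π^*(h) = h₀·ε·v₁`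
  have ha : Ideal.span {h₀ * ε} = Ideal.span {φ h} := by
    have := map_stalkIdeal_eq_mul_of_mem hEs hT hπ left_mem_pairFace x'
    rw [hHx, Ideal.map_span, Set.image_singleton, hH₀, hε, Ideal.span_singleton_mul_span_singleton] at this
    exact this.symm
  obtain ⟨v₁, hv₁⟩ := Ideal.span_singleton_eq_span_singleton.mp ha
  -- (b) the two monomials: `π^*(m_b) = m_b'·v₂` (marking `0`), `π^*(m_μ) = ε·m_μ'·v₃` (marking `1 ≤ weightOf L T`)
  have hwL : 1 ≤ weightOf L T := by
    rw [hTdef, weightOf_pairFace hHK]; omega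
  obtain ⟨v₂, hv₂⟩ := Ideal.span_singleton_eq_span_singleton.mp
    (span_pow_mul_generator_eq hEs hT hπ (Nat.zero_le _) hbx hε hmb')
  obtain ⟨v₃, hv₃⟩ := Ideal.span_singleton_eq_span_singleton.mp (span_pow_mul_generator_eq hEsL hTL hπ hwL hμx hε hmμ')
  rw [pow_zero, one_mul] at hv₂
  rw [pow_one] at hv₃
  -- (c) the derivation: chart extension (T19a-ii) and logarithmicity along the new frame (T19c's transport, face `{H, K}`)
  have hCmap : (stalkIdeal (T.sup id) (π x')).map φ = Ideal.span {ε} := by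
    rw [← stalkIdeal_comap_eq_map_stalkMap]; exact hε
  obtain ⟨δ', hδ', hcomm⟩ :=
    exists_isDeriv_transform hEs hT hπ x' hδ fun K' hK' hyK g hg => hlog K' (hT K' hK') hyK g hg
  have hlogC : ∀ g ∈ stalkIdeal (T.sup id) (π x'), δ g ∈ stalkIdeal (T.sup id) (π x') := by
    rw [stalkIdeal_finsetSup T (π x')]
    refine hδ.log_finsetSup T (fun K' => stalkIdeal K' (π x')) fun K' hK' g hg => ?_
    by_cases hyK : π x' ∈ K'.support
    · exact hlog K' (hT K' hK') hyK g hg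
    · rw [stalkIdeal_eq_top_of_not_mem_support hyK]; exact Submodule.mem_top
  have hlogε : ∀ g ∈ Ideal.span {ε}, δ' g ∈ Ideal.span {ε} := by
    rw [← hCmap]
    exact fun g hg => hδ'.log_map φ hcomm hlogC hg
  have hstrict : ∀ K' ∈ H :: boundaryOf E, x' ∈ (strictTransformIdeal π (T.sup id) K').support →
      ∀ g ∈ stalkIdeal (strictTransformIdeal π (T.sup id) K') x',
        δ' g ∈ stalkIdeal (strictTransformIdeal π (T.sup id) K') x' := by
    intro K' hK' hxK
    have hyK : π x' ∈ K'.support := mem_support_of_mem_support_strictTransformIdeal hxK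
    have hlogK : ∀ g ∈ stalkIdeal K' (π x'), δ g ∈ stalkIdeal K' (π x') := hlog K' hK' hyK
    by_cases hKT : K' ∈ T
    · have hmul := map_stalkIdeal_eq_mul_of_mem hEs hT hπ hKT x'
      rw [hε] at hmul
      intro g hg
      refine hδ'.log_of_log_mul hε0 (hlogε ε (Ideal.mem_span_singleton_self ε)) (fun x hx => ?_) hg
      rw [← hmul] at hx ⊢
      exact hδ'.log_map φ hcomm hlogK hx
    · intro g hg
      rw [← map_stalkIdeal_eq_of_not_mem hEs hT hπ hK' hKT x'] at hg ⊢
      exact hδ'.log_map φ hcomm hlogK hg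
  have hlog' : ∀ G ∈ strictTransformIdeal π (T.sup id) H :: boundaryOf (transformExp E π T 0), x' ∈ G.support →
      ∀ g ∈ stalkIdeal G x', δ' g ∈ stalkIdeal G x' := by
    intro G hG' hxG
    rcases List.mem_cons.mp hG' with rfl | hG'
    · exact hstrict H List.mem_cons_self hxG
    · rw [boundaryOf_transformExp, List.mem_append, List.mem_map, List.mem_singleton] at hG'
      rcases hG' with ⟨K', hK', rfl⟩ | rfl
      · exact hstrict K' (List.mem_cons_of_mem _ hK') hxG
      · rw [hε]; exact hlogε
  -- (d) the eigen relation — exact, because `δ'(v₃ᵖ) = 0`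
  have hp1 : 1 ≤ p := hP.prime.one_lt.le
  have hp0' : ((p : ℕ) : X'.presheaf.stalk x') = 0 := by
    have h0 := congrArg φ (hP.cast_eq_zero (π x'))
    rwa [map_natCast, map_zero] at h0
  have hprod : φ v * ↑v₂ * ↑v₃ ^ (p - 1) * (φ c * ↑v₃) * mb' = φ (v * c * mb) * ↑v₃ ^ p := by
    obtain ⟨q, hq⟩ : ∃ q, p = q + 1 := ⟨p - 1, by omega⟩
    rw [map_mul, map_mul, ← hv₂, hq, Nat.add_sub_cancel, pow_succ]
    ring
  have heig' : δ' (φ v * ↑v₂ * ↑v₃ ^ (p - 1) * (φ c * ↑v₃) * mb') =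
      φ lam * (φ v * ↑v₂ * ↑v₃ ^ (p - 1) * (φ c * ↑v₃) * mb') := by
    rw [hprod, hδ'.leibniz (φ (v * c * mb)) (↑v₃ ^ p), hδ'.map_pow_eq_zero_of_natCast hp0' ↑v₃, mul_zero, zero_add,
      hcomm (v * c * mb), heig, map_mul]
    ring
  -- (e) the transformed datum
  refine ⟨h₀ * ↑v₁, mb', mμ', φ c * ↑v₃, φ v * ↑v₂ * ↑v₃ ^ (p - 1), δ', φ lam, (hc.map φ).mul v₃.isUnit,
    ((hv.map φ).mul v₂.isUnit).mul (v₃.isUnit.pow _), ?_, hmb', hmμ', ?_, hδ', hlog', hlam.map φ, heig'⟩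
  · rw [hH₀, Ideal.span_singleton_mul_right_unit v₁.isUnit]
  · rw [MarkedIdeal.transform_ideal, hP.mult_eq, hπ.stalkIdeal_controlledTransform, stalkIdeal_comap_eq_map_stalkMap,
      hIx, Ideal.map_span, Set.image_singleton, hε, ← hφ,
      map_latent_generator_eq φ hp1 c v (h' := h₀ * ↑v₁) (ε := ε) (mb' := mb') (mμ' := mμ') (v₂ := ↑v₂) (v₃ := ↑v₃)
        (by rw [← hv₁]; ring) hv₂.symm hv₃.symm,
      colon_span_pow_mul hε0]

/-- ★ **THE LATENT-JET SHAPE SURVIVES THE LATENT HOP, given the guard `supp M' ⊆ V(H')`** (terminal labels at marking `0`, latent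
labels at marking `1`; the label clauses by L20b's `label_transformExp`). [new] [cite: Kollar2007, (3.111) Step 3] -/
theorem ncHypShapeLatJ.transform_of_support_subset (hEs : HasSNC (H :: boundaryOf E)) (hK : K ∈ boundaryOf E) (hHK : H ≠ K)
    (hπ : IsBlowup π ((pairFace H K).sup id)) (hLK : 1 ≤ expOf L K) (hP : ncHypShapeLatJ p X E L H M)
    (hSupp : (M.transform π ((pairFace H K).sup id)).support ⊆
      ((strictTransformIdeal π ((pairFace H K).sup id) H).support : Set X')) :
    ncHypShapeLatJ p X' (transformExp E π (pairFace H K) 0) (transformExp L π (pairFace H K) 1)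
      (strictTransformIdeal π ((pairFace H K).sup id) H) (M.transform π ((pairFace H K).sup id)) := by
  haveI : IsProper π := hπ.isProper
  haveI : IsLocallyNoetherian X' := LocallyOfFiniteType.isLocallyNoetherian π
  have hT : ∀ K' ∈ pairFace H K, K' ∈ H :: boundaryOf E := pair_subset_frame hK
  have hTL : ∀ K' ∈ pairFace H K, K' ∈ H :: boundaryOf L := by rw [hP.boundaryOf_eq]; exact hT
  refine ⟨by rw [MarkedIdeal.transform_mult, hP.mult_eq], label_transformExp hEs hT hπ 0 fun _ hq hqH => hP.labelE hq hqH,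
    label_transformExp (hP.hasSNC_L hEs) hTL hπ 1 fun _ hq hqH => hP.labelL hq hqH, ?_,
    fun x' hx' => hP.latJAt_transform hEs hK hHK hπ hLK hx', hSupp, hP.prime, fun x' => ?_⟩
  · rw [boundaryOf_transformExp, boundaryOf_transformExp, hP.boundaryOf_eq]
  · have h := congrArg (π.stalkMap x').hom (hP.cast_eq_zero (π x'))
    rwa [map_natCast, map_zero] at h

end Round

end Summit.ResolutionOfSingularities.ResolutionOfSingularities.Theorems.DeltaCutClasses

end
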